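import Mathlib
import HarnessLib
import Summits.AnomalousDissipation.AnomalousDissipation.Theses.MirrorVariety

/-!
# Sketch (crux-ideate r1, ideator 2) — crux `MirrorVariety.TaylorGreenLoudGalerkinStates`
(stmt-AnomalousDissipation-2987). First lemmas of idea card `reynolds-series-sheet-jump`
(and the shared eigenforce identity used by card `eigenforce-transfer-pinch` if filed).
Props only (no proofs required at the ideate stage); everything is stated over existing
declarations of `Literature.Analysis.FunctionSpaces.Torus` and the crux's own tested form.
-/

namespace Summit.AnomalousDissipation.AnomalousDissipation.Cruxes.TaylorGreenLoudGalerkinStates.ReynoldsSeriesSheetJump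

open MeasureTheory
open Literature.Analysis.FunctionSpaces Literature.Analysis.FunctionSpaces.Torus

local notation "𝕋³" => UnitAddTorus (Fin 3)
local notation "E³" => EuclideanSpace ℝ (Fin 3)

/-- The Taylor–Green force of the crux, literally as in `MirrorVariety.TaylorGreenLoudGalerkinStates`. -/
noncomputable def tgForce : 𝕋³ → E³ := fun x =>
  !₂[(fourier 1 (x 0) : ℂ).im * (fourier 1 (x 1) : ℂ).re * (fourier 1 (x 2) : ℂ).re,
     -((fourier 1 (x 0) : ℂ).re * (fourier 1 (x 1) : ℂ).im * (fourier 1 (x 2) : ℂ).re), (0 : ℝ)]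

/-- Band-limited to the punctured frequency ball of radius `N` (the crux's clause). -/
def IsBandLimited (N : ℕ) (U : 𝕋³ → E³) : Prop :=
  ∀ k ∉ (freqBall N).erase (0 : Fin 3 → ℤ),
    UnitAddTorus.mFourierCoeff (EuclideanSpace.complexify ∘ U) k = 0

/-- The crux's tested steady Galerkin equations at resolution `N`, viscosity `ν`, force `f`. -/
def IsGalerkinSteady (N : ℕ) (ν : ℝ) (f U : 𝕋³ → E³) : Prop :=
  IsSmooth U ∧ IsDivFree U ∧ HasZeroMean U ∧ IsBandLimited N U ∧
  ∀ a : 𝕋³ → E³, IsSmooth a → IsDivFree a → IsBandLimited N a →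
    ∫ x, (inner ℝ (U x) (convect U a x) + ν * inner ℝ (U x) (laplacian a x)
      + inner ℝ (f x) (a x)) = 0

/-- Transfer functional `T_f(U) = ∫ ⟪U, (U·∇) f⟫ = ∫ Uᵀ S_f U`: the Reynolds stress of `U` tested
against the strain of the force (minus the energy transfer out of the forcing mode). -/
noncomputable def transfer (f U : 𝕋³ → E³) : ℝ := ∫ x, inner ℝ (U x) (convect U f x)

/-- FIRST LEMMA (eigenforce work identity). `f_TG` is a Stokes eigenfield on the shell `|k|² = 3`
(`Δ f_TG = -12π² f_TG`), band-limited for `N ≥ 2`, hence an admissible TEST FIELD of the crux's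
Galerkin equations: testing with `a = f_TG` gives `12π²ν (f,U) = ‖f‖² + T_f(U)`, testing with
`a = U` gives the energy identity `(f,U) = ν‖∇U‖²`. So the crux's loudness clause
`ε ≤ ν‖∇U‖²` reads `T_f(U) ≥ -‖f‖² + 12π²νε`: EVERY bounded Galerkin steady TG state at small `ν`
has its transfer pinned to `-‖f‖² + O(ν)`, and loud/quiet is decided in the `O(ν)` layer.
This is also order `p = 1, 2` of the Reynolds series of the card. Size S–M (Fourier support of
`tgForce`, `laplacian` of a single-shell trig field, linearity of the tested form in `a`). -/
def EigenforceWorkIdentity : Prop :=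
  ∀ (N : ℕ) (ν : ℝ) (U : 𝕋³ → E³), 2 ≤ N → IsGalerkinSteady N ν tgForce U →
    12 * Real.pi ^ 2 * ν * (∫ x, inner ℝ (tgForce x) (U x))
        = (∫ x, ‖tgForce x‖ ^ 2) + transfer tgForce U
      ∧ (∫ x, inner ℝ (tgForce x) (U x)) = ν * gradNormSq U

/-- Corollary: loudness ⇔ transfer deficit (pure algebra from `EigenforceWorkIdentity`, `ν > 0`). -/
def LoudIffTransferDeficit : Prop :=
  ∀ (N : ℕ) (ν ε : ℝ) (U : 𝕋³ → E³), 2 ≤ N → 0 < ν → IsGalerkinSteady N ν tgForce U →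
    (ε ≤ ν * gradNormSq U ↔
      -(∫ x, ‖tgForce x‖ ^ 2) + 12 * Real.pi ^ 2 * ν * ε ≤ transfer tgForce U)

/-- Support lemma (order-2 shells). `(f_TG·∇) f_TG` has Fourier support on the shells
`|k|² ∈ {0, 4, 8, 12}` (sums of two vectors of `{±1}³`); the mean mode pairs to zero against a
divergence-free test. Hence the order-2 Reynolds coefficient of the steady TG state lives on the
shells `4, 8, 12`, the shell-3 balance is untouched at order 2, and `f_TG` is "one Reynolds step
from Euler-steady" in a quantified sense. -/
def OrderTwoShells : Prop :=
  ∀ a : 𝕋³ → E³, IsSmooth a → IsDivFree a →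
    (∀ k : Fin 3 → ℤ, (freqNormSq k = 4 ∨ freqNormSq k = 8 ∨ freqNormSq k = 12) →
        UnitAddTorus.mFourierCoeff (EuclideanSpace.complexify ∘ a) k = 0) →
    ∫ x, inner ℝ (tgForce x) (convect tgForce a x) = 0

/-- Support lemma (Stokes germ, uniform in `N`): above a viscosity threshold independent of the
resolution the Galerkin steady TG state is unique (contraction; Temam Ch. II §1 Thm 1.3-type).
It is the base point of the laminar Reynolds/Stokes series whose analytic continuation the card
studies; uniqueness uniform in `N` is what makes the series coefficients `N`-exact. -/
def StokesGermUnique : Prop :=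
  ∃ ν₀ : ℝ, 0 < ν₀ ∧ ∀ (N : ℕ) (ν : ℝ) (U V : 𝕋³ → E³), ν₀ ≤ ν →
    IsGalerkinSteady N ν tgForce U → IsGalerkinSteady N ν tgForce V → U = V

/-- Reynolds-coefficient exactness, typed without a recursion: order-`p` data of the laminar
family are insensitive to the resolution once `N² ≥ 3p²`. Stated for FAMILIES: if `U N ν` is the
unique Galerkin steady state for `ν ≥ ν₀` (StokesGermUnique) then for every `p` the `p`-th
`ν⁻¹`-Taylor datum at `ν = ∞` … — kept informal here; the checkable finite form we will use is:
two resolutions `N ≤ N'` with `3 p² ≤ N²` have laminar states agreeing to order `ν^{1-2p}`: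
`‖U N ν - U N' ν‖_{L²} ≤ C_p ν^{-(2p+1)}` for `ν ≥ ν₀` (squared below). -/
def CoefficientExactness : Prop :=
  ∀ p : ℕ, ∃ C ν₀ : ℝ, 0 < ν₀ ∧ ∀ (N N' : ℕ) (ν : ℝ) (U U' : 𝕋³ → E³),
    3 * (p : ℝ) ^ 2 ≤ (N : ℝ) ^ 2 → N ≤ N' → ν₀ ≤ ν →
    IsGalerkinSteady N ν tgForce U → IsGalerkinSteady N' ν tgForce U' →
    ∫ x, ‖U x - U' x‖ ^ 2 ≤ C * ν ^ (-(4 * (p : ℝ) + 2))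

/-- Sanity: the crux decl is in scope by name (this sketch does not prove it). -/
example : Prop := Summit.AnomalousDissipation.AnomalousDissipation.Theses.MirrorVariety.TaylorGreenLoudGalerkinStates

end Summit.AnomalousDissipation.AnomalousDissipation.Cruxes.TaylorGreenLoudGalerkinStates.ReynoldsSeriesSheetJump
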